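import Literature.Computability.Cryptography.HallgrenClassGroup
import Literature.NumberTheory.QuadraticFields.QuadraticDedekindZetaKronecker
import Literature.NumberTheory.QuadraticFields.QuadraticDedekindZetaZeros
import Literature.NumberTheory.QuadraticFields.KroneckerCharacterFourProofs
import Literature.NumberTheory.QuadraticFields.JacobiCharacterPrimitiveProofs
import Literature.NumberTheory.LFunctions.LandauPageRealZeros
import Literature.NumberTheory.LFunctions.SiegelTheorem

/-!
# Crux `ArithStatLadder.IqThreeMemBQP` (stmt-QuantumAdvantage-2424), line `scholz-mirror-siegel` — stub `stub_mirrorDichotomy`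

Registered stub S1 of the line skeleton `Cruxes/IqThreeMemBQP/Lines/scholz_mirror_siegel.lean` (the
MIRROR DICHOTOMY; signature stated over tree constants only, verbatim the registered one).

Proof summary ("a quadratic field and its Scholz mirror are never both dark", effective, no Siegel).
* `exists_primitive_kroneckerChar`: every quadratic field `K` has a PRIMITIVE quadratic Dirichlet
  character `κ ≠ 1` mod `|d_K|` with `ζ_K(s) = ζ(s) L(s, κ)` on `Re s > 1` (the tree's
  `Quadratic.exists_kroneckerChar`, with primitivity added from `isPrimitive_jacobiChar` (odd `d_K`)
  and `isPrimitive_of_forall_odd` (even `d_K = 4m`)); by the class number formula in residue form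
  (`Quadratic.LFunction_one_eq_dedekindZeta_residue_of_eq`) `Re L(1, κ) = κ_K`, the residue of `ζ_K`.
* `quadChar_pair_dichotomy`: an absolute `c > 0` such that for primitive quadratic `χ₁` mod `q₁ ≥ 2`,
  `χ₂` mod `q₂ ≤ 3q₁`, `q₁ ≠ q₂`: `Re L(1, χ₁) ≥ c/log q₁` or `Re L(1, χ₂) ≥ c/log q₁`. Indeed
  `χ₁χ₂` (mod `q₁q₂`) is non-principal (`DirichletZFR.prodChar_ne_one_of_isPrimitive`), so by
  Landau's repulsion (`DirichletZFR.exists_landau_prodChar_min_le`, MV Thm 11.7) with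
  `η = min(1/4, c_L/(2(log q₁q₂ + log 4)))` at most one of `L(s, χᵢ)` vanishes on `[1 − η, 1)`; for
  the other, MV Thm 11.14 Case A (`Siegel.caseA`) gives `Re L(1, χᵢ) ≥ c_E η (B qᵢ)^{−A_E η}`, and
  `η ≥ c₁/log q₁`, `A_E η log(B qᵢ) ≤ E₀` (absolute) give `≥ c/log q₁`.
* The stub: for `d ≥ 4`, if some quadratic `K₀` with `d_{K₀} = −d` violates the bound, apply the pair
  dichotomy to `κ_{K₀}` (mod `d`) and `κ_F` (mod `D⁺ ∈ {d/3, 3d}`) for every quadratic `F` with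
  `d_F = D⁺`.
-/

namespace Summit.QuantumAdvantage.QuantumAdvantage.Theorems.ArithStatLadder.IqThreeMemBQP

open scoped NumberField nonZeroDivisors
open _root_.Computability Literature.Computability.Complexity Literature.Computability.Cryptography
open Literature.NumberTheory.QuadraticFields

/-! ## Helper lemmas -/

section Helpers

open Literature.NumberTheory.QuadraticFields.Quadratic Literature.NumberTheory.LFunctions
open scoped NumberTheorySymbols

/-- **A primitive Kronecker character for every quadratic field**: for `[K : ℚ] = 2` there is a
primitive quadratic Dirichlet character `κ ≠ 1` modulo `|d_K|` with `ζ_K(s) = ζ(s) L(s, κ)` for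
`Re s > 1`. This is `Quadratic.exists_kroneckerChar` with primitivity recorded: odd `d_K` gives the
Jacobi character `(· / |d_K|)`, primitive as `|d_K|` is odd and squarefree
(`isPrimitive_jacobiChar`); even `d_K = 4m` gives the character mod `4|m|` with values `(m / n)` at
odd `n`, primitive by `isPrimitive_of_forall_odd`.
[cite: MontgomeryVaughan2007, §10.1 Exercise 26 and Theorem 9.13] -/
private theorem exists_primitive_kroneckerChar {K : Type*} [Field K] [NumberField K]
    (h2 : Module.finrank ℚ K = 2) :
    ∃ (M : ℕ) (_ : NeZero M) (κ : DirichletCharacter ℂ M), M = (NumberField.discr K).natAbs ∧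
      κ ≠ 1 ∧ κ ^ 2 = 1 ∧ κ.IsPrimitive ∧
      ∀ s : ℂ, 1 < s.re →
        NumberField.dedekindZeta K s = riemannZeta s * LSeries (fun n ↦ κ n) s := by
  -- adapted from `Quadratic.exists_kroneckerChar` (QuadraticDedekindZetaZeros.lean)
  rcases isFundamentalDiscriminant_discr (K := K) h2 with ⟨h1, hsq1, -⟩ | ⟨h4, hm4, hsq⟩
  · -- odd discriminant
    have hodd : Odd (NumberField.discr K) := by
      rw [Int.odd_iff]; omega
    haveI := neZero_natAbs_discr (K := K)
    exact ⟨(NumberField.discr K).natAbs, inferInstance, jacobiChar (NumberField.discr K).natAbs, rfl,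
      jacobiChar_natAbs_discr_ne_one h2 hodd,
      MulChar.IsQuadratic.sq_eq_one (fun a ↦ jacobiChar_trichotomy a),
      isPrimitive_jacobiChar (Int.natAbs_odd.mpr hodd) (Int.squarefree_natAbs.mpr hsq1),
      fun s hs ↦ dedekindZeta_eq_riemannZeta_mul_LSeries h2 hodd hs⟩
  · -- even discriminant `d = 4m`
    set m : ℤ := NumberField.discr K / 4 with hm
    have hm0 : m ≠ 0 := hsq.ne_zero
    have hdm : NumberField.discr K = 4 * m := by rw [hm, Int.mul_ediv_cancel' h4]
    haveI : NeZero (4 * m.natAbs) := ⟨mul_ne_zero (by norm_num) (Int.natAbs_ne_zero.mpr hm0)⟩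
    obtain ⟨κ, hκ⟩ := exists_dirichletCharacter_four_mul m hm0
    have hprim : κ.IsPrimitive := isPrimitive_of_forall_odd hm4 hsq hκ
    have hM : 4 * m.natAbs = (NumberField.discr K).natAbs := by
      rw [hdm, Int.natAbs_mul]; rfl
    have hne : κ ≠ 1 := by
      intro h
      have hc : κ.conductor = 4 * m.natAbs := hprim
      rw [h, DirichletCharacter.conductor_one] at hc
      have := Int.natAbs_pos.mpr hm0
      omega
    refine ⟨4 * m.natAbs, inferInstance, κ, hM, hne, (isQuadratic_of_forall_odd hm0 hκ).sq_eq_one,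
      hprim, fun s hs ↦ ?_⟩
    refine dedekindZeta_eq_riemannZeta_mul_LSeries_of_kronecker h2 κ (fun p hp hp2 ↦ ?_) ?_ hs
    · -- odd primes: `κ(p) = (m/p) = (4m/p) = (d/p)`
      have hpodd : Odd p := hp.odd_of_ne_two hp2
      rw [hκ p hpodd, hdm, jacobiSym.mul_left]
      have h4 : J(4 | p) = 1 := by
        rw [show (4 : ℤ) = 2 ^ 2 by norm_num]
        exact jacobiSym.sq_one' (by
          rw [show (2 : ℤ) = ((2 : ℕ) : ℤ) by rfl, Int.gcd_natCast_natCast]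
          exact (Nat.coprime_primes Nat.prime_two hp).mpr (Ne.symm hp2))
      rw [h4, one_mul]
    · -- the prime `2`: `κ(2) = 0` and `d ≡ 0, 4 (mod 8)`
      have h81 : NumberField.discr K % 8 ≠ 1 := by omega
      have h85 : NumberField.discr K % 8 ≠ 5 := by omega
      rw [if_neg h81, if_neg h85]
      refine apply_eq_zero_of_even (m := m) ?_
      have hlt : 2 < 4 * m.natAbs := by have := Int.natAbs_pos.mpr hm0; omega
      have : ((2 : ℕ) : ZMod (4 * m.natAbs)) = 2 := by norm_cast
      rw [← this, ZMod.val_natCast, Nat.mod_eq_of_lt hlt]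
      exact even_two

/-- **The residue as an `L`-value**: for a quadratic field `K`, `Re L(1, κ) = κ_K` (the residue of
`ζ_K` at `s = 1`) for a primitive quadratic Dirichlet character `κ ≠ 1` modulo `|d_K|`
(`exists_primitive_kroneckerChar` and the class number formula in residue form,
`Quadratic.LFunction_one_eq_dedekindZeta_residue_of_eq`).
[cite: NeukirchANT1999, Ch. VII §5 (5.11)] -/
private theorem exists_primitive_char_residue {K : Type*} [Field K] [NumberField K]
    (h2 : Module.finrank ℚ K = 2) :
    ∃ (M : ℕ) (_ : NeZero M) (κ : DirichletCharacter ℂ M), M = (NumberField.discr K).natAbs ∧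
      κ ≠ 1 ∧ κ ^ 2 = 1 ∧ κ.IsPrimitive ∧
      (κ.LFunction 1).re = NumberField.dedekindZeta_residue K := by
  obtain ⟨M, _, κ, hM, hκ, hsq, hprim, hfac⟩ := exists_primitive_kroneckerChar h2
  refine ⟨M, inferInstance, κ, hM, hκ, hsq, hprim, ?_⟩
  rw [LFunction_one_eq_dedekindZeta_residue_of_eq hκ (fun s hs ↦ hfac s (by simpa using hs))]
  exact Complex.ofReal_re _

/-- **The pair dichotomy** (Landau's repulsion + MV Thm 11.14 Case A): there is an absolute `c > 0`
such that for primitive quadratic non-principal `χ₁` mod `q₁`, `χ₂` mod `q₂` with `q₁ ≠ q₂`,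
`2 ≤ q₁`, `q₂ ≤ 3q₁`, at least one of `Re L(1, χ₁)`, `Re L(1, χ₂)` is `≥ c/log q₁`. Proof: `χ₁χ₂`
(mod `q₁q₂`) is non-principal, so with `ℒ = log q₁q₂ + log 4` and `η = min(1/4, c_L/(2ℒ))` Landau's
theorem forbids real zeros of both `L(s, χ₁)` and `L(s, χ₂)` on `[1 − η, 1)`; the zero-free one
satisfies `Re L(1, χᵢ) ≥ c_E η (B qᵢ)^{−A_E η}` (Case A), and `η ≥ c₁/log q₁`,
`A_E η log(B qᵢ) ≤ E₀` with absolute `c₁, E₀` since `ℒ ≤ 6 log q₁` and `log q₁ ≤ ℒ`.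
[cite: Landau1918] [cite: MontgomeryVaughan2007, §11.2 Theorem 11.7 and Theorem 11.14 (Case A)] -/
private theorem quadChar_pair_dichotomy :
    ∃ c : ℝ, 0 < c ∧ ∀ (q₁ q₂ : ℕ) [NeZero q₁] [NeZero q₂]
      (χ₁ : DirichletCharacter ℂ q₁) (χ₂ : DirichletCharacter ℂ q₂),
      q₁ ≠ q₂ → 2 ≤ q₁ → q₂ ≤ 3 * q₁ →
      χ₁ ≠ 1 → χ₁ ^ 2 = 1 → χ₁.IsPrimitive → χ₂ ≠ 1 → χ₂ ^ 2 = 1 → χ₂.IsPrimitive →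
        c / Real.log q₁ ≤ (χ₁.LFunction 1).re ∨ c / Real.log q₁ ≤ (χ₂.LFunction 1).re := by
  obtain ⟨cL, hcL, hLandau⟩ := DirichletZFR.exists_landau_prodChar_min_le
  have hA := Estermann.estermannA_pos
  have hC := Estermann.estermannC_pos
  have hB1 := Siegel.one_le_ballConst
  have hlog2 : 0 < Real.log 2 := Real.log_pos (by norm_num)
  have hLB0 : 0 ≤ Real.log Siegel.ballConst := Real.log_nonneg hB1
  have hlog3 : 0 ≤ Real.log 3 := Real.log_nonneg (by norm_num)
  -- the absolute constants
  set c₁ : ℝ := min (Real.log 2 / 4) (cL / 12) with hc₁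
  have hc₁0 : 0 < c₁ := lt_min (by positivity) (by positivity)
  set E₀ : ℝ := Estermann.estermannA * ((Real.log Siegel.ballConst + Real.log 3) / 4 + cL / 2)
    with hE₀
  refine ⟨Estermann.estermannC * c₁ * Real.exp (-E₀), mul_pos (mul_pos hC hc₁0) (Real.exp_pos _),
    fun q₁ q₂ _ _ χ₁ χ₂ hne hq₁ hq₂ hχ₁ h₁ hp₁ hχ₂ h₂ hp₂ ↦ ?_⟩
  -- sizes
  have hq₁r : (2 : ℝ) ≤ q₁ := by exact_mod_cast hq₁
  have hq₂r : (q₂ : ℝ) ≤ 3 * q₁ := by exact_mod_cast hq₂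
  have hq₂1 : (1 : ℝ) ≤ q₂ := by exact_mod_cast NeZero.one_le
  have hlogq₁ : Real.log 2 ≤ Real.log q₁ := Real.log_le_log two_pos hq₁r
  have hlogq₁0 : 0 < Real.log q₁ := hlog2.trans_le hlogq₁
  have hlogq₂0 : 0 ≤ Real.log q₂ := Real.log_nonneg hq₂1
  have hlogq₂ : Real.log q₂ ≤ Real.log 3 + Real.log q₁ := by
    rw [← Real.log_mul (by norm_num) (by positivity)]
    exact Real.log_le_log (by positivity) hq₂r
  have hlog4 : Real.log 4 = 2 * Real.log 2 := by
    rw [show (4 : ℝ) = 2 ^ 2 by norm_num, Real.log_pow]; norm_num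
  have hlog34 : Real.log 3 ≤ Real.log 4 := Real.log_le_log (by norm_num) (by norm_num)
  set ℒ : ℝ := Real.log ((q₁ : ℝ) * q₂) + Real.log 4 with hℒ
  have hℒeq : ℒ = Real.log q₁ + Real.log q₂ + Real.log 4 := by
    rw [hℒ, Real.log_mul (by positivity) (by positivity)]
  have hℒ₁ : Real.log q₁ ≤ ℒ := by rw [hℒeq]; linarith
  have hℒpos : 0 < ℒ := hlogq₁0.trans_le hℒ₁
  have hℒle : ℒ ≤ 6 * Real.log q₁ := by rw [hℒeq]; linarith
  -- the width `η`
  set η : ℝ := min (1 / 4) (cL / (2 * ℒ)) with hη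
  have hη0 : 0 < η := lt_min (by norm_num) (by positivity)
  have hη4 : η ≤ 1 / 4 := min_le_left _ _
  have hη2 : η ≤ cL / (2 * ℒ) := min_le_right _ _
  have hηL : η < cL / ℒ := hη2.trans_lt (by
    rw [div_lt_div_iff₀ (by positivity) hℒpos]; nlinarith)
  have hηlow : c₁ / Real.log q₁ ≤ η := by
    refine le_min ?_ ?_
    · rw [div_le_iff₀ hlogq₁0]
      linarith [min_le_left (Real.log 2 / 4) (cL / 12)]
    · rw [div_le_div_iff₀ hlogq₁0 (by positivity)]
      calc c₁ * (2 * ℒ) ≤ cL / 12 * (2 * ℒ) :=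
            mul_le_mul_of_nonneg_right (min_le_right _ _) (by positivity)
        _ ≤ cL / 12 * (12 * Real.log q₁) := mul_le_mul_of_nonneg_left (by linarith) (by positivity)
        _ = cL * Real.log q₁ := by ring
  -- the Case A lower bound is `≥ c / log q₁` for every modulus `q ≤ 3 q₁`
  have hlow : ∀ q : ℝ, 1 ≤ q → q ≤ 3 * q₁ →
      Estermann.estermannC * c₁ * Real.exp (-E₀) / Real.log q₁ ≤
        Estermann.estermannC * η * (Siegel.ballConst * q) ^ (-Estermann.estermannA * η) := by
    intro q hq1 hq3
    have hBq0 : 0 < Siegel.ballConst * q := by positivity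
    have hlogq : Real.log q ≤ Real.log 3 + Real.log q₁ := by
      rw [← Real.log_mul (by norm_num) (by positivity)]
      exact Real.log_le_log (by positivity) hq3
    have hexp : (Siegel.ballConst * q) ^ (-Estermann.estermannA * η) =
        Real.exp (-(Estermann.estermannA * (η * Real.log Siegel.ballConst + η * Real.log q))) := by
      rw [Real.rpow_def_of_pos hBq0, Real.log_mul (by positivity) (by positivity)]
      congr 1; ring
    have e1 : η * Real.log Siegel.ballConst ≤ 1 / 4 * Real.log Siegel.ballConst :=
      mul_le_mul_of_nonneg_right hη4 hLB0
    have e2 : η * Real.log q ≤ η * Real.log 3 + η * Real.log q₁ := by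
      rw [← mul_add]; exact mul_le_mul_of_nonneg_left hlogq hη0.le
    have e3 : η * Real.log 3 ≤ 1 / 4 * Real.log 3 := mul_le_mul_of_nonneg_right hη4 hlog3
    have e4 : η * Real.log q₁ ≤ cL / (2 * ℒ) * Real.log q₁ :=
      mul_le_mul_of_nonneg_right hη2 hlogq₁0.le
    have e5 : cL / (2 * ℒ) * Real.log q₁ ≤ cL / (2 * ℒ) * ℒ :=
      mul_le_mul_of_nonneg_left hℒ₁ (by positivity)
    have e6 : cL / (2 * ℒ) * ℒ = cL / 2 := by field_simp
    have hsum : Estermann.estermannA * (η * Real.log Siegel.ballConst + η * Real.log q) ≤ E₀ := by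
      rw [hE₀]
      exact mul_le_mul_of_nonneg_left (by linarith) hA.le
    calc Estermann.estermannC * c₁ * Real.exp (-E₀) / Real.log q₁
        = Estermann.estermannC * (c₁ / Real.log q₁) * Real.exp (-E₀) := by ring
      _ ≤ Estermann.estermannC * η *
          Real.exp (-(Estermann.estermannA * (η * Real.log Siegel.ballConst + η * Real.log q))) :=
          mul_le_mul (mul_le_mul_of_nonneg_left hηlow hC.le) (Real.exp_le_exp.mpr (by linarith))
            (by positivity) (by positivity)
      _ = Estermann.estermannC * η * (Siegel.ballConst * q) ^ (-Estermann.estermannA * η) := by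
          rw [hexp]
  -- not both `L(s, χ₁)` and `L(s, χ₂)` vanish on `[1 - η, 1)` (Landau)
  have hnot : ¬ ((∃ β₁ : ℝ, 1 - η ≤ β₁ ∧ β₁ < 1 ∧ χ₁.LFunction β₁ = 0) ∧
      (∃ β₂ : ℝ, 1 - η ≤ β₂ ∧ β₂ < 1 ∧ χ₂.LFunction β₂ = 0)) := by
    rintro ⟨⟨β₁, hβ₁, -, hz₁⟩, ⟨β₂, hβ₂, -, hz₂⟩⟩
    have hψ := DirichletZFR.prodChar_ne_one_of_isPrimitive χ₁ hp₁ χ₂ hp₂ h₂ hne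
    have hmin := hLandau q₁ q₂ χ₁ χ₂ hχ₁ hχ₂ h₁ h₂ hψ β₁ β₂ hz₁ hz₂
    have : 1 - η ≤ min β₁ β₂ := le_min hβ₁ hβ₂
    linarith
  by_cases hZ : ∃ β₁ : ℝ, 1 - η ≤ β₁ ∧ β₁ < 1 ∧ χ₁.LFunction β₁ = 0
  · -- `L(s, χ₁)` has an exceptional zero, so `L(s, χ₂)` is zero-free on `[1 - η, 1)`
    right
    have hz : ∀ σ : ℝ, 1 - η ≤ σ → σ < 1 → χ₂.LFunction σ ≠ 0 :=
      fun σ hσ hσ1 h0 ↦ hnot ⟨hZ, σ, hσ, hσ1, h0⟩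
    have key := Siegel.caseA χ₂ hχ₂ h₂ hη0 hη4 hz
    exact (hlow q₂ hq₂1 hq₂r).trans key
  · -- `L(s, χ₁)` is zero-free on `[1 - η, 1)`
    left
    have hz : ∀ σ : ℝ, 1 - η ≤ σ → σ < 1 → χ₁.LFunction σ ≠ 0 :=
      fun σ hσ hσ1 h0 ↦ hZ ⟨σ, hσ, hσ1, h0⟩
    have key := Siegel.caseA χ₁ hχ₁ h₁ hη0 hη4 hz
    exact (hlow q₁ (by linarith) (by linarith)).trans key

end Helpers

/-! ## The registered stub (signature verbatim) -/

/-- **S1 `stub_mirrorDichotomy`** ("a field and its Scholz mirror are never both dark", in residue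
form; effective, no Siegel): an absolute `c > 0` and `d₀ = 4` such that for every `d ≥ d₀`:
`κ_K ≥ c/log d` for every quadratic `K` of discriminant `−d`, OR `κ_F ≥ c/log d` for every quadratic
`F` of discriminant `D⁺ = mirrorDisc d` (`= d/3` if `3 ∣ d`, else `3d`). Proof: if some quadratic
`K₀` with `d_{K₀} = −d` has `κ_{K₀} < c/log d`, take its primitive Kronecker character `κ₁` mod `d`
(`exists_primitive_char_residue`: `Re L(1, κ₁) = κ_{K₀}`); for every quadratic `F` with `d_F = D⁺`
and primitive Kronecker character `κ₂` mod `D⁺` (`D⁺ ≠ d`, `D⁺ ≤ 3d`) the pair dichotomy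
`quadChar_pair_dichotomy` — Landau's repulsion `DirichletZFR.exists_landau_prodChar_min_le` for the
non-principal `κ₁κ₂` (`DirichletZFR.prodChar_ne_one_of_isPrimitive`) plus MV Thm 11.14 Case A
`Siegel.caseA` for the zero-free character — gives `Re L(1, κ₁) ≥ c/log d` (excluded) or
`κ_F = Re L(1, κ₂) ≥ c/log d`. (The hypothesis that `−d` is fundamental is not needed.)
[cite: Landau1918] [cite: MontgomeryVaughan2007, Thm 11.7, Thm 11.14] -/
theorem stub_mirrorDichotomy :
    ∃ c : ℝ, 0 < c ∧ ∃ d₀ : ℕ, ∀ d : ℕ, d₀ ≤ d → IsNegFundamentalDiscr d →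
      (∀ (K : Type) [Field K] [NumberField K], Module.finrank ℚ K = 2 →
        NumberField.discr K = -(d : ℤ) → c / Real.log d ≤ NumberField.dedekindZeta_residue K) ∨
      (∀ (F : Type) [Field F] [NumberField F], Module.finrank ℚ F = 2 →
        NumberField.discr F = (if 3 ∣ d then ((d / 3 : ℕ) : ℤ) else 3 * (d : ℤ)) →
          c / Real.log d ≤ NumberField.dedekindZeta_residue F) := by
  obtain ⟨c, hc, H⟩ := quadChar_pair_dichotomy
  refine ⟨c, hc, 4, fun d hd _ ↦ ?_⟩
  rcases Classical.em (∃ (K : Type) (_ : Field K) (_ : NumberField K), Module.finrank ℚ K = 2 ∧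
      NumberField.discr K = -(d : ℤ) ∧ NumberField.dedekindZeta_residue K < c / Real.log d) with
    ⟨K, _, _, h2K, hdK, hltK⟩ | hnone
  · -- some `K₀` of discriminant `-d` is dark: every mirror field is bright
    right
    intro F _ _ h2F hdF
    obtain ⟨M₁, _, κ₁, hM₁, hκ₁, hsq₁, hp₁, hres₁⟩ := exists_primitive_char_residue h2K
    obtain ⟨M₂, _, κ₂, hM₂, hκ₂, hsq₂, hp₂, hres₂⟩ := exists_primitive_char_residue h2F
    have hM₁d : M₁ = d := by rw [hM₁, hdK, Int.natAbs_neg, Int.natAbs_natCast]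
    have hM₂d : M₂ = d / 3 ∨ M₂ = 3 * d := by
      rw [hM₂, hdF]
      split_ifs
      · exact Or.inl (Int.natAbs_natCast _)
      · right
        rw [Int.natAbs_mul, Int.natAbs_natCast]
        rfl
    have hne : M₁ ≠ M₂ := by omega
    have h2le : 2 ≤ M₁ := by omega
    have hle3 : M₂ ≤ 3 * M₁ := by omega
    have hM₁r : (M₁ : ℝ) = d := by exact_mod_cast hM₁d
    rcases H M₁ M₂ κ₁ κ₂ hne h2le hle3 hκ₁ hsq₁ hp₁ hκ₂ hsq₂ hp₂ with h | h
    · rw [hres₁, hM₁r] at h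
      exact absurd h (not_le.mpr hltK)
    · rw [hres₂, hM₁r] at h
      exact h
  · -- every `K` of discriminant `-d` is bright
    left
    intro K _ _ h2K hdK
    by_contra hlt
    exact hnone ⟨K, inferInstance, inferInstance, h2K, hdK, not_le.mp hlt⟩

end Summit.QuantumAdvantage.QuantumAdvantage.Theorems.ArithStatLadder.IqThreeMemBQP
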